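import Summits.QuantumFields.YangMills.Theorems.AlphaInputsT3ACv3SmoothLiftCandidateDefect
import Summits.QuantumFields.YangMills.Theorems.AlphaInputsT3ACv3NewtonLiftFlat
import HarnessLib

/-!
# `AlphaInputsT3ACv3SmoothLiftExactFlat` — ★★★ THE MODEL `hLift` (flat frame, whole torus): **every `𝔰𝔲(n)`-valued coarse datum `A` with `‖A‖ ≤ M` small has an EXACT non-abelian fine lift** —
# a finest `SU(n)` field `U` with `Ū^{(k)} = exp A` on EVERY coarse bond ((0.4)∕EML averaging of record) and EVERY finest plaquette within `O(M)·(L^k)⁻²`, the constant `k`-FREE — the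
# by-name junction ★★OWNER g25 (2026-08-28T01:58:53Z (c)) asked for: this seat's START `exists_start_for_newtonFlat_allL` (`…SmoothLiftCandidateDefect`) ∘ ★w4-19936's model Newton lift
# `NewtonLiftFlat.exists_exact_lift_flat` (p596187) — cell `ym3-torus`, width seat `ym-ust-19936-w2` (g2)

WHY.  RULING g24-№4 made the `hLift` binder of `…v3InnerLiftFromRegionalThm1` the (FL) deliverable; its MODEL (frames = 1, Ω = the torus) is «small coarse logarithmic data ⇒ exact smooth lift».
★w4's theorem turns ANY `η`-flat start `U₀` with `η₀`-small multiplicative defect against `V` into an exact lift, under ONE k-free profile in `(L^k·η, η₀, r·L^k)`; this seat's start has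
`L^k·η = 2C_S·M`, `η₀ = O(M²)`, and we take `r := M/L^k`, so every row becomes a `k`-FREE smallness condition on `M` (the `hwin`-type row of the eventual `hLift`).
WHAT (no definitions).  ★★★ `exists_exactLift_of_data_flat`: hypotheses = `d+2 ≤ L` (★w4's theorem uses ★w1's R3; the AllL twin of R3 is ★w5's p594803 — swapping it inside `NewtonLiftFlat` removes the
proviso), `k ≤ m+K`, `A c ∈ lieSU n`, `‖A c‖ ≤ M`, `0 < M`, and the explicit k-free rows (the start's `4C_S·M ≤ 1`, `M ≤ 1∕4`, AllL guards; the Newton rows with `L^k·4r = 4M`, `L^k(2r+η) = (2+2C_S)M`,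
`L^k·2r = 2M`, `L^k·η = 2C_S M` substituted, a free defect budget `η₀ ≥ (K₁+3)M²` with `4C_S·η₀ ≤ M`); conclusion = `∃ U a`, `a` `𝔰𝔲(n)`-valued with `‖a_b‖ ≤ 4C_S·η₀/L^k`, `U_b = e^{a_b}·(cand k A)_b`,
`Ū^{(k)} = dataSU k A` on EVERY coarse bond, and `dist1 U(∂p) ≤ (4·18^d·M + 16(C_S M)² + (16·18^d + 128C_S²·M + 256C_S²·η₀)·η₀)/(L^k)²` at EVERY finest plaquette.
HONEST FRAMING.  A composition of landed kernel theorems (this seat's START + ★w4's R6-FLAT + ★w3's (V) + ★w1's R1–R3 + ★w5's AllL); it is the MODEL case only — the regional∕stencil `hLift`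
(frames, ∂Ω start, double cones) is NOT claimed, nor the stub, the crux or the gap; count-neutral helper (`--supports stmt-QuantumFields-19936`); registry untouched; YM₃ on T³ is rung R3, not
the Clay problem.

References: T. Bałaban, Commun. Math. Phys. 102 (1985) 277–309 [Balaban1985Variational] (Thm 1 (8) p.279, (11)–(15) pp.279–280); Commun. Math. Phys. 98 (1985) 17–51 [Balaban1985Averaging]
(Props. 4–5 (134)–(135) p.38, (156)–(157) p.42); Commun. Math. Phys. 109 (1987) 249–301 [Balaban1987RG1] ((0.4)+(0.11) p.253).
-/

set_option autoImplicit false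

noncomputable section

open scoped Matrix.Norms.L2Operator
open NormedSpace

namespace Summit.QuantumFields.YangMills.Theorems.SmoothLiftCandidate

open Literature.MathematicalPhysics.QuantumFieldTheory.Balaban1983to89
open T4Continuum AveragingRT BlockAveraging ExpMeanLog BlockAveragingEMLLinearised
open Literature.MathematicalPhysics.QuantumFieldTheory.Balaban1983to89.T4AdjointCovarianceUnitary (lieSU expSU coe_expSU mem_lieSU_iff)
open Summit.QuantumFields.YangMills.Theorems.LinearLiftMatrix (CS CS_nonneg)
open Summit.QuantumFields.YangMills.Theorems.NewtonLiftFlat (exists_exact_lift_flat CS_pos)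

variable {P : Params} {n : Type*} [Fintype n] [DecidableEq n] [Nonempty n] (k : ℕ) (hk : k ≤ P.m + P.K)
include hk

/-- **★★★ THE MODEL `hLift`: EVERY SMALL COARSE DATUM `exp A` HAS AN EXACT NON-ABELIAN FINE LIFT WITH `O(M)·L^{−2k}` PLAQUETTES, `k`-UNIFORMLY** (flat frame, whole torus).
START = `cand k A` (`…SmoothLiftCandidateDefect.exists_start_for_newtonFlat_allL`: `‖U₀ − 1‖ ≤ 2C_S M/L^k`, plaquettes `≤ (4·18^d M + 16(C_S M)²)/(L^k)²`, defect `≤ (K₁+3)M² ≤ η₀`), STEP =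
★w4's `NewtonLiftFlat.exists_exact_lift_flat` with `r := M/L^k`, `η := 2C_S M/L^k`.  All rows are `k`-free smallness conditions on `M` (and on the chosen defect budget `η₀`).
[cite: Balaban1985Variational, Thm 1 (8) p.279, (11)–(15) pp.279–280; Balaban1985Averaging, Prop. 4 (134)–(135) p.38] -/
theorem exists_exactLift_of_data_flat (hL : P.d + 2 ≤ P.L) (A : PBond P k → Matrix n n ℂ) (hA : ∀ c, A c ∈ lieSU n) {M η₀ : ℝ} (hMpos : 0 < M) (hM : ∀ c, ‖A c‖ ≤ M)
    -- the start's rows (★w5's AllL guards at `m = 2(d+1)C_S·M`)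
    (hM4 : 4 * (CS P * M) ≤ 1) (hMq : M ≤ 1 / 4)
    (hm : (((P.d : ℝ) + 1) * ((18 : ℝ) ^ P.d * (2 + ((P.d : ℝ) + 1) * (18 : ℝ) ^ P.d)) * (324 * (((P.d + 2) * P.L : ℕ) : ℝ) ^ 2) / ((P.L : ℝ) * ((P.L : ℝ) - 1))) *
        (2 * (((P.d : ℝ) + 1) * (CS P * M))) ≤ 1)
    (h32 : 32 * (((P.d + 2) * P.L : ℕ) : ℝ) * (2 * (((P.d : ℝ) + 1) * (CS P * M))) ≤ 1)
    (hNs : 4 * (((P.d + 2) * P.L : ℕ) : ℝ) * (2 * (((P.d : ℝ) + 1) * (CS P * M))) < deltaSU n)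
    -- the defect budget: at least the start's defect, and small
    (hη₀ : (((((P.d : ℝ) + 1) * ((18 : ℝ) ^ P.d * (2 + ((P.d : ℝ) + 1) * (18 : ℝ) ^ P.d)) * (324 * (((P.d + 2) * P.L : ℕ) : ℝ) ^ 2) / ((P.L : ℝ) * ((P.L : ℝ) - 1))) *
            (2 * (((P.d : ℝ) + 1) * CS P)) ^ 2 + ((P.d : ℝ) + 1) * CS P ^ 2) + 3) * M ^ 2 ≤ η₀)
    (hdef : 4 * CS P * η₀ ≤ M)
    -- ★w4's Newton rows with `L^k·4r = 4M`, `L^k·(2r+η) = (2+2C_S)M`, `L^k·2r = 2M`, `L^k·η = 2C_S·M`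
    (h5200 : 5200 * (P.L : ℝ) * ((P.d : ℝ) + 2) ^ 2 *
      (2 * (Fintype.card n : ℝ) ^ 2 * (((P.d : ℝ) + 1) * (4 * M)) + 2 * (Fintype.card n : ℝ) ^ 2 * (((P.d : ℝ) + 1) * ((2 + 2 * CS P) * M))) ≤ 1)
    (hN : 4 * (((P.d + 2) * P.L : ℕ) : ℝ) *
      (2 * (Fintype.card n : ℝ) ^ 2 * (((P.d : ℝ) + 1) * (4 * M)) + 2 * (Fintype.card n : ℝ) ^ 2 * (((P.d : ℝ) + 1) * ((2 + 2 * CS P) * M))) < deltaSU n)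
    (hρD : 2 * (2 * (Fintype.card n : ℝ) ^ 2 * (((P.d : ℝ) + 1) * (2 * M))) + η₀ ≤ 1 / 4)
    (hρπ : (Fintype.card n : ℝ) * (2 * (2 * (Fintype.card n : ℝ) ^ 2 * (((P.d : ℝ) + 1) * (2 * M))) + η₀) < Real.pi)
    (hcontr : ((P.d : ℝ) + 1) * CS P *
      (16 * (Fintype.card n : ℝ) ^ 2 * (2 * (2 * (Fintype.card n : ℝ) ^ 2 * (((P.d : ℝ) + 1) * (2 * M))) + η₀) +
          20800 * (Fintype.card n : ℝ) ^ 2 * (P.L : ℝ) * ((P.d : ℝ) + 2) ^ 2 *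
            (2 * (Fintype.card n : ℝ) ^ 2 * (((P.d : ℝ) + 1) * (4 * M)) + 2 * (Fintype.card n : ℝ) ^ 2 * (((P.d : ℝ) + 1) * ((2 + 2 * CS P) * M))) +
          (2 + 2 * CS P) * M + (2 * (2 * (Fintype.card n : ℝ) ^ 2 * (((P.d : ℝ) + 1) * (2 * CS P * M))) + η₀)) ≤ 1 / 2) :
    ∃ (U : GaugeField P 0 (Matrix.specialUnitaryGroup n ℂ)) (a : PBond P 0 → Matrix n n ℂ),
      (∀ b, a b ∈ lieSU n) ∧ (∀ b, ((U b : Matrix.specialUnitaryGroup n ℂ) : Matrix n n ℂ) = exp (a b) * (cand k A hA b : Matrix n n ℂ)) ∧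
      (∀ b, ‖a b‖ ≤ 4 * CS P * η₀ / (P.L : ℝ) ^ k) ∧
      (∀ c : PBond P k, Averaging.iter (fun i => blockAvg (P := P) (j := i) (expMeanLogSU (n := n))) k U c = dataSU k A hA c) ∧
      (∀ p : Plaq P 0, GaugeGroup.dist1 (GaugeField.plaqHol U p) ≤
        (4 * (18 : ℝ) ^ P.d * M + 16 * (CS P * M) ^ 2 + (16 * (18 : ℝ) ^ P.d + 128 * CS P ^ 2 * M + 256 * CS P ^ 2 * η₀) * η₀) / ((P.L : ℝ) ^ k) ^ 2) := by
  have hCS := CS_pos P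
  have hLpos : (0 : ℝ) < P.L := by exact_mod_cast P.L_pos
  have hLk : (0 : ℝ) < (P.L : ℝ) ^ k := pow_pos hLpos k
  have hL1 : (1 : ℝ) ≤ (P.L : ℝ) ^ k := one_le_pow₀ (by exact_mod_cast P.hL.2.le)
  have hLm1 : (0 : ℝ) < (P.L : ℝ) - 1 := by
    have h2 : (1 : ℝ) < P.L := by exact_mod_cast P.hL.2
    linarith
  have hM0 : 0 ≤ M := hMpos.le
  have hM1' : M ≤ 1 := by linarith
  -- the defect budget is nonnegative
  have hη₀nn : 0 ≤ η₀ := by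
    refine le_trans (mul_nonneg (add_nonneg (add_nonneg (mul_nonneg ?_ (sq_nonneg _)) (by positivity)) (by norm_num)) (sq_nonneg M)) hη₀
    exact div_nonneg (by positivity) (mul_pos hLpos hLm1).le
  -- the start `U₀ := cand k A hA`
  have hM1 : CS P * M ≤ 1 := by linarith [mul_nonneg hCS.le hM0]
  have hU₀ : ∀ b, ‖((cand k A hA b : Matrix.specialUnitaryGroup n ℂ) : Matrix n n ℂ) - 1‖ ≤ 2 * (CS P * M / (P.L : ℝ) ^ k) :=
    fun b => (norm_coe_cand_sub_one_le k hk A hA hM hM1 b).1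
  have hplaq₀ := fun q => dist1_plaqHol_cand_le k hk A hA hM hM4 q
  have hdef₀ := fun c => norm_iter_cand_mul_star_data_sub_one_le_allL k hk A hA hM hM1 hM1' hm h32 hNs c
  -- the Newton step with `r := M/L^k`, `η := 2 C_S M / L^k`
  set r : ℝ := M / (P.L : ℝ) ^ k with hr
  set η : ℝ := 2 * (CS P * M / (P.L : ℝ) ^ k) with hη
  have hrpos : 0 < r := div_pos hMpos hLk
  have hrM : r ≤ M := div_le_self hM0 hL1
  have hr4 : r ≤ 1 / 4 := hrM.trans hMq
  have hηnn : 0 ≤ η := by rw [hη]; exact mul_nonneg (by norm_num) (div_nonneg (mul_nonneg hCS.le hM0) hLk.le)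
  -- the `L^k`-scaled letters of ★w4's rows
  have e4 : ((P.d : ℝ) + 1) * (P.L : ℝ) ^ k * (4 * r) = ((P.d : ℝ) + 1) * (4 * M) := by rw [hr]; field_simp
  have e2η : ((P.d : ℝ) + 1) * (P.L : ℝ) ^ k * (2 * r + η) = ((P.d : ℝ) + 1) * ((2 + 2 * CS P) * M) := by rw [hr, hη]; field_simp
  have e2 : ((P.d : ℝ) + 1) * (P.L : ℝ) ^ k * (2 * r) = ((P.d : ℝ) + 1) * (2 * M) := by rw [hr]; field_simp
  have eη : ((P.d : ℝ) + 1) * (P.L : ℝ) ^ k * η = ((P.d : ℝ) + 1) * (2 * CS P * M) := by rw [hη]; field_simp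
  have eLη : (P.L : ℝ) ^ k * η = 2 * CS P * M := by rw [hη]; field_simp
  have hη2 : η ≤ 2 * (CS P * M) := by
    rw [hη]; exact mul_le_mul_of_nonneg_left (div_le_self (mul_nonneg hCS.le hM0) hL1) (by norm_num)
  have h2rη : 2 * r + η ≤ (2 + 2 * CS P) * M := by
    have e : (2 + 2 * CS P) * M = 2 * M + 2 * (CS P * M) := by ring
    rw [e]; linarith [hrM, hη2]
  have hdef' : 4 * CS P * η₀ ≤ r * (P.L : ℝ) ^ k := by rw [hr, div_mul_cancel₀ M hLk.ne']; exact hdef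
  -- ★w4's rows from the k-free ones
  have h5200' : 5200 * (P.L : ℝ) * ((P.d : ℝ) + 2) ^ 2 *
      (2 * (Fintype.card n : ℝ) ^ 2 * (((P.d : ℝ) + 1) * (P.L : ℝ) ^ k * (4 * r)) + 2 * (Fintype.card n : ℝ) ^ 2 * (((P.d : ℝ) + 1) * (P.L : ℝ) ^ k * (2 * r + η))) ≤ 1 := by
    rw [e4, e2η]; exact h5200
  have hN' : 4 * (((P.d + 2) * P.L : ℕ) : ℝ) *
      (2 * (Fintype.card n : ℝ) ^ 2 * (((P.d : ℝ) + 1) * (P.L : ℝ) ^ k * (4 * r)) + 2 * (Fintype.card n : ℝ) ^ 2 * (((P.d : ℝ) + 1) * (P.L : ℝ) ^ k * (2 * r + η))) < deltaSU n := by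
    rw [e4, e2η]; exact hN
  have hρD' : 2 * (2 * (Fintype.card n : ℝ) ^ 2 * (((P.d : ℝ) + 1) * (P.L : ℝ) ^ k * (2 * r))) + η₀ ≤ 1 / 4 := by rw [e2]; exact hρD
  have hρπ' : (Fintype.card n : ℝ) * (2 * (2 * (Fintype.card n : ℝ) ^ 2 * (((P.d : ℝ) + 1) * (P.L : ℝ) ^ k * (2 * r))) + η₀) < Real.pi := by rw [e2]; exact hρπ
  have hcontr' : ((P.d : ℝ) + 1) * CS P *
      (16 * (Fintype.card n : ℝ) ^ 2 * (2 * (2 * (Fintype.card n : ℝ) ^ 2 * (((P.d : ℝ) + 1) * (P.L : ℝ) ^ k * (2 * r))) + η₀) +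
          20800 * (Fintype.card n : ℝ) ^ 2 * (P.L : ℝ) * ((P.d : ℝ) + 2) ^ 2 *
            (2 * (Fintype.card n : ℝ) ^ 2 * (((P.d : ℝ) + 1) * (P.L : ℝ) ^ k * (4 * r)) + 2 * (Fintype.card n : ℝ) ^ 2 * (((P.d : ℝ) + 1) * (P.L : ℝ) ^ k * (2 * r + η))) +
          (2 * r + η) + (2 * (2 * (Fintype.card n : ℝ) ^ 2 * (((P.d : ℝ) + 1) * (P.L : ℝ) ^ k * η)) + η₀)) ≤ 1 / 2 := by
    rw [e2, e4, e2η, eη]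
    refine le_trans ?_ hcontr
    have hc0 : 0 ≤ ((P.d : ℝ) + 1) * CS P := mul_nonneg (by positivity) hCS.le
    exact mul_le_mul_of_nonneg_left (by linarith [h2rη]) hc0
  -- ★w4's theorem
  obtain ⟨U, a, ha_su, hUa, ha_le, hexact, hplaq⟩ := exists_exact_lift_flat (n := n) hL hk (cand k A hA) (dataSU k A hA) hrpos hr4 hηnn hη₀nn hU₀
    (fun c => (hdef₀ c).trans hη₀) h5200' hN' hρD' hρπ' hcontr' hdef'
  refine ⟨U, a, ha_su, hUa, ha_le, hexact, fun p => ?_⟩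
  have h := (hplaq p).trans (add_le_add (hplaq₀ p) le_rfl)
  rw [eLη] at h
  have e : 4 * (18 : ℝ) ^ P.d * M / ((P.L : ℝ) ^ k) ^ 2 + 16 * (CS P * M / (P.L : ℝ) ^ k) ^ 2 +
      (16 * (18 : ℝ) ^ P.d + 64 * CS P * (2 * CS P * M) + 256 * CS P ^ 2 * η₀) * η₀ / ((P.L : ℝ) ^ k) ^ 2 =
      (4 * (18 : ℝ) ^ P.d * M + 16 * (CS P * M) ^ 2 + (16 * (18 : ℝ) ^ P.d + 128 * CS P ^ 2 * M + 256 * CS P ^ 2 * η₀) * η₀) / ((P.L : ℝ) ^ k) ^ 2 := by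
    field_simp
    ring
  rw [← e]
  exact h

end Summit.QuantumFields.YangMills.Theorems.SmoothLiftCandidate

end
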